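import Summits.CriticalPhenomena.PercolationContinuityZ3.Theorems.PercNearOneGluingNoHeavyPcintKernZ5B4Defs
import HarnessLib

/-!
# PCINT lane, kernel check 1/2 of the B3r window certificate `d = 5`, memory 4 (3-step windows, 1000 codes): codes `0 ≤ c < 500`

Cell `prim-pcint`, seat `prim-pcint-2` (gen 2).  Collatz–Wielandt rows `10^5 · row ≤ 99999 · DEN · v` for the window codes in
`[0, 500)`, by `decide +kernel` in chunks of `50` codes (natural-number arithmetic only; `maxHeartbeats 0`).
Does NOT build on p205010.
-/

namespace Summit.CriticalPhenomena.PercolationContinuityZ3.Theorems.Pcint.Z5B4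

set_option maxHeartbeats 0 in
/-- Rows `0 ≤ c < 50` of the certificate hold. [folklore] -/
theorem chk_0_50 : WinK.allRange (WinK.rowOKB 5 2 1136 10065 9936 99999 tbl 88354) 0 50 = true := by decide +kernel

set_option maxHeartbeats 0 in
/-- Rows `50 ≤ c < 100` of the certificate hold. [folklore] -/
theorem chk_50_100 : WinK.allRange (WinK.rowOKB 5 2 1136 10065 9936 99999 tbl 88354) 50 100 = true := by decide +kernel

set_option maxHeartbeats 0 in
/-- Rows `100 ≤ c < 150` of the certificate hold. [folklore] -/
theorem chk_100_150 : WinK.allRange (WinK.rowOKB 5 2 1136 10065 9936 99999 tbl 88354) 100 150 = true := by decide +kernel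

set_option maxHeartbeats 0 in
/-- Rows `150 ≤ c < 200` of the certificate hold. [folklore] -/
theorem chk_150_200 : WinK.allRange (WinK.rowOKB 5 2 1136 10065 9936 99999 tbl 88354) 150 200 = true := by decide +kernel

set_option maxHeartbeats 0 in
/-- Rows `200 ≤ c < 250` of the certificate hold. [folklore] -/
theorem chk_200_250 : WinK.allRange (WinK.rowOKB 5 2 1136 10065 9936 99999 tbl 88354) 200 250 = true := by decide +kernel

set_option maxHeartbeats 0 in
/-- Rows `250 ≤ c < 300` of the certificate hold. [folklore] -/
theorem chk_250_300 : WinK.allRange (WinK.rowOKB 5 2 1136 10065 9936 99999 tbl 88354) 250 300 = true := by decide +kernel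

set_option maxHeartbeats 0 in
/-- Rows `300 ≤ c < 350` of the certificate hold. [folklore] -/
theorem chk_300_350 : WinK.allRange (WinK.rowOKB 5 2 1136 10065 9936 99999 tbl 88354) 300 350 = true := by decide +kernel

set_option maxHeartbeats 0 in
/-- Rows `350 ≤ c < 400` of the certificate hold. [folklore] -/
theorem chk_350_400 : WinK.allRange (WinK.rowOKB 5 2 1136 10065 9936 99999 tbl 88354) 350 400 = true := by decide +kernel

set_option maxHeartbeats 0 in
/-- Rows `400 ≤ c < 450` of the certificate hold. [folklore] -/
theorem chk_400_450 : WinK.allRange (WinK.rowOKB 5 2 1136 10065 9936 99999 tbl 88354) 400 450 = true := by decide +kernel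

set_option maxHeartbeats 0 in
/-- Rows `450 ≤ c < 500` of the certificate hold. [folklore] -/
theorem chk_450_500 : WinK.allRange (WinK.rowOKB 5 2 1136 10065 9936 99999 tbl 88354) 450 500 = true := by decide +kernel

/-- Rows `0 ≤ c < 500` of the certificate hold. [folklore] -/
theorem chkFile_1 : WinK.allRange (WinK.rowOKB 5 2 1136 10065 9936 99999 tbl 88354) 0 500 = true :=
  chk_split (chk_split (chk_split (chk_split (chk_split (chk_split (chk_split (chk_split (chk_split chk_0_50 chk_50_100) chk_100_150) chk_150_200) chk_200_250) chk_250_300) chk_300_350) chk_350_400) chk_400_450) chk_450_500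

end Summit.CriticalPhenomena.PercolationContinuityZ3.Theorems.Pcint.Z5B4
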